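import Mathlib
import Literature.Probability.LatticeModels.RandomCluster

/-!
# Joint versus separate wiring of two boundary arcs — the component count

Support lemma for crux `UniformZeroFree` (stmt-CriticalPhenomena-5559) of route `CardyQContinuation`.
The crux weights a bond configuration `ω` by `s^(|ω| + 2 k_B(ω))` with the two discrete arcs `A = (ab)_δ`,
`B = (cd)_δ` wired JOINTLY (`wired (A ∪ B)`: one block).  Miller–Werner / Chelkak–Smirnov wire them
SEPARATELY (`wired A ⊔ wired B`: two blocks).  For every configuration the two cluster counts differ by
exactly the indicator of "no open crossing":  `k_sep = k_joint + [A and B are not joined]`, because the extra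
edges of the joint wiring only ever merge the component of `A` with the component of `B`.  This file proves
that statement for an arbitrary graph `G` on a finite vertex type (`wiring_card_connectedComponent`), which is
the combinatorial core of the polynomial identity `s² Z_joint = Z_sep + (s² − 1) N` relating the three
normalisations of the crossing ratio (joint `N/Z_joint`, separate, symmetric) by Möbius maps.
[folklore; Grimmett2006 §1.2 (wired counts)]
-/

namespace Summit.CriticalPhenomena.CardyFormulaZ2.Theorems.UniformZeroFree

open Literature.Probability.LatticeModels SimpleGraph

variable {V : Type*}

/-- The jointly wired graph dominates the separately wired one: `wired A ⊔ wired B ≤ wired (A ∪ B)`. [folklore] -/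
theorem wiring_sep_le_joint (G : SimpleGraph V) (A B : Set V) :
    G ⊔ wired A ⊔ wired B ≤ G ⊔ wired (A ∪ B) := by
  intro x y h
  simp only [sup_adj, wired_adj, Set.mem_union] at h ⊢
  rcases h with (h | ⟨hne, hx, hy⟩) | ⟨hne, hx, hy⟩
  · exact Or.inl h
  · exact Or.inr ⟨hne, Or.inl hx, Or.inl hy⟩
  · exact Or.inr ⟨hne, Or.inr hx, Or.inr hy⟩

/-- An edge of the jointly wired graph is an edge of the separately wired graph or joins two vertices of
`A ∪ B`. [folklore] -/
theorem wiring_joint_adj_cases {G : SimpleGraph V} {A B : Set V} {x y : V}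
    (h : (G ⊔ wired (A ∪ B)).Adj x y) :
    (G ⊔ wired A ⊔ wired B).Adj x y ∨ (x ∈ A ∪ B ∧ y ∈ A ∪ B) := by
  simp only [sup_adj, wired_adj] at h ⊢
  rcases h with h | ⟨_, hx, hy⟩
  · exact Or.inl (Or.inl (Or.inl h))
  · exact Or.inr ⟨hx, hy⟩

/-- A set of vertices closed under adjacency contains every vertex reachable from one of its points.
[folklore] -/
theorem wiring_reachable_mem_of_closed {H : SimpleGraph V} {S : Set V}
    (hS : ∀ ⦃x y⦄, x ∈ S → H.Adj x y → y ∈ S) {a b : V} (ha : a ∈ S) (hab : H.Reachable a b) : b ∈ S := by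
  rw [reachable_iff_reflTransGen] at hab
  induction hab with
  | refl => exact ha
  | tail _ hxy ih => exact hS ih hxy

/-- All vertices of `A` lie in one component of the separately wired graph. [folklore] -/
theorem wiring_reachable_of_mem_left {G : SimpleGraph V} {A B : Set V} {a a' : V} (ha : a ∈ A) (ha' : a' ∈ A) :
    (G ⊔ wired A ⊔ wired B).Reachable a a' := by
  by_cases h : a = a'
  · subst h; exact Reachable.refl _
  · refine Adj.reachable ?_
    simp only [sup_adj, wired_adj]
    exact Or.inl (Or.inr ⟨h, ha, ha'⟩)

/-- All vertices of `B` lie in one component of the separately wired graph. [folklore] -/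
theorem wiring_reachable_of_mem_right {G : SimpleGraph V} {A B : Set V} {b b' : V} (hb : b ∈ B) (hb' : b' ∈ B) :
    (G ⊔ wired A ⊔ wired B).Reachable b b' := by
  by_cases h : b = b'
  · subst h; exact Reachable.refl _
  · refine Adj.reachable ?_
    simp only [sup_adj, wired_adj]
    exact Or.inr ⟨h, hb, hb'⟩

/-- KEY STEP. If a vertex `u` is separately-reachable neither from `A` nor from `B`, then its jointly-wired
component equals its separately-wired component: joint reachability from `u` implies separate reachability.
[folklore] -/
theorem wiring_sep_reachable_of_joint_reachable {G : SimpleGraph V} {A B : Set V} {u v : V}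
    (huA : ∀ a ∈ A, ¬ (G ⊔ wired A ⊔ wired B).Reachable u a)
    (huB : ∀ b ∈ B, ¬ (G ⊔ wired A ⊔ wired B).Reachable u b)
    (h : (G ⊔ wired (A ∪ B)).Reachable u v) : (G ⊔ wired A ⊔ wired B).Reachable u v := by
  -- the set of vertices separately reachable from `u` is closed under joint adjacency
  refine wiring_reachable_mem_of_closed (H := G ⊔ wired (A ∪ B))
    (S := {w | (G ⊔ wired A ⊔ wired B).Reachable u w}) ?_ (Reachable.refl u) h
  intro x y hx hxy
  rcases wiring_joint_adj_cases hxy with hsep | ⟨hxAB, -⟩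
  · exact hx.trans hsep.reachable
  · exfalso
    rcases hxAB with hxA | hxB
    · exact huA x hxA hx
    · exact huB x hxB hx

section Count

variable [Finite V]

open scoped Classical in
/-- **Component count under joint versus separate wiring.**  For nonempty `A`, `B`:
`#CC(G ⊔ wired A ⊔ wired B) = #CC(G ⊔ wired (A ∪ B)) + [A, B not joined in G ⊔ wired A ⊔ wired B]`.
[folklore; Grimmett2006 §1.2] -/
theorem wiring_card_connectedComponent (G : SimpleGraph V) {A B : Set V} (hA : A.Nonempty) (hB : B.Nonempty) :
    Nat.card (G ⊔ wired A ⊔ wired B).ConnectedComponent =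
      Nat.card (G ⊔ wired (A ∪ B)).ConnectedComponent +
        (if ∃ a ∈ A, ∃ b ∈ B, (G ⊔ wired A ⊔ wired B).Reachable a b then 0 else 1) := by
  classical
  obtain ⟨a₀, ha₀⟩ := hA
  obtain ⟨b₀, hb₀⟩ := hB
  set S := G ⊔ wired A ⊔ wired B with hSdef
  set J := G ⊔ wired (A ∪ B) with hJdef
  have hle : S ≤ J := wiring_sep_le_joint G A B
  let φ : S.ConnectedComponent → J.ConnectedComponent := ConnectedComponent.map (Hom.ofLE hle)
  have hφ : ∀ v : V, φ (S.connectedComponentMk v) = J.connectedComponentMk v := fun v => rfl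
  have hφsurj : Function.Surjective φ := by
    intro d
    induction d using ConnectedComponent.ind with
    | h v => exact ⟨S.connectedComponentMk v, hφ v⟩
  -- the condition "A and B joined" is equivalent to `cA = cB`
  set cA := S.connectedComponentMk a₀
  set cB := S.connectedComponentMk b₀
  have hcond : (∃ a ∈ A, ∃ b ∈ B, S.Reachable a b) ↔ cA = cB := by
    constructor
    · rintro ⟨a, ha, b, hb, hab⟩
      exact ConnectedComponent.sound
        (((wiring_reachable_of_mem_left ha₀ ha).trans hab).trans (wiring_reachable_of_mem_right hb hb₀))
    · intro h
      exact ⟨a₀, ha₀, b₀, hb₀, ConnectedComponent.exact h⟩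
  -- `φ cA = φ cB`
  have hφAB : φ cA = φ cB := by
    rw [hφ, hφ]
    by_cases hab : a₀ = b₀
    · rw [hab]
    · refine ConnectedComponent.sound (Adj.reachable ?_)
      simp only [hJdef, sup_adj, wired_adj, Set.mem_union]
      exact Or.inr ⟨hab, Or.inl ha₀, Or.inr hb₀⟩
  -- fibres of `φ` away from `cA`, `cB` are singletons
  have hkey : ∀ c c' : S.ConnectedComponent, c ≠ cA → c ≠ cB → φ c' = φ c → c' = c := by
    intro c c'
    induction c using ConnectedComponent.ind with
    | h u =>
      induction c' using ConnectedComponent.ind with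
      | h v =>
        intro hA' hB' hφeq
        rw [hφ, hφ, ConnectedComponent.eq] at hφeq
        have huA : ∀ a ∈ A, ¬ S.Reachable u a := fun a ha hua =>
          hA' (ConnectedComponent.sound (hua.trans (wiring_reachable_of_mem_left ha ha₀)))
        have huB : ∀ b ∈ B, ¬ S.Reachable u b := fun b hb hub =>
          hB' (ConnectedComponent.sound (hub.trans (wiring_reachable_of_mem_right hb hb₀)))
        exact ConnectedComponent.sound
          (wiring_sep_reachable_of_joint_reachable huA huB hφeq.symm).symm
  by_cases hAB : cA = cB
  · -- joined: `φ` is a bijection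
    rw [if_pos (hcond.2 hAB), add_zero]
    refine Nat.card_eq_of_bijective φ ⟨?_, hφsurj⟩
    intro c₁ c₂ h
    by_cases h₁ : c₁ = cA
    · by_cases h₂ : c₂ = cA
      · rw [h₁, h₂]
      · exact (hkey c₂ c₁ h₂ (hAB ▸ h₂) h)
    · exact (hkey c₁ c₂ h₁ (hAB ▸ h₁) h.symm).symm
  · -- not joined: `φ` restricted to `{c // c ≠ cB}` is a bijection
    rw [if_neg (fun h => hAB (hcond.1 h))]
    have hbij : Function.Bijective (fun c : {c : S.ConnectedComponent // c ≠ cB} => φ c.1) := by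
      constructor
      · rintro ⟨c₁, hc₁⟩ ⟨c₂, hc₂⟩ h
        simp only at h
        apply Subtype.ext
        show c₁ = c₂
        by_cases h₁ : c₁ = cA
        · by_cases h₂ : c₂ = cA
          · rw [h₁, h₂]
          · exact hkey c₂ c₁ h₂ hc₂ h
        · exact (hkey c₁ c₂ h₁ hc₁ h.symm).symm
      · intro d
        obtain ⟨c, rfl⟩ := hφsurj d
        by_cases hc : c = cB
        · exact ⟨⟨cA, hAB⟩, by simp only [hc, hφAB]⟩
        · exact ⟨⟨c, hc⟩, rfl⟩
    have h1 : Nat.card {c : S.ConnectedComponent // c ≠ cB} + 1 = Nat.card S.ConnectedComponent := by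
      haveI := Fintype.ofFinite S.ConnectedComponent
      rw [Nat.card_eq_fintype_card, Nat.card_eq_fintype_card, Fintype.card_subtype_compl,
        Fintype.card_subtype_eq]
      have : 1 ≤ Fintype.card S.ConnectedComponent :=
        Fintype.card_pos_iff.2 ⟨cB⟩
      omega
    rw [← h1, Nat.card_eq_of_bijective _ hbij]

end Count

end Summit.CriticalPhenomena.CardyFormulaZ2.Theorems.UniformZeroFree
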